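import Literature.NumberTheory.EllipticCurves.KramerTunnell1982.UnramifiedNormIndex
import Literature.NumberTheory.EllipticCurves.Tamagawa
import Literature.NumberTheory.EllipticCurves.QuadraticTwist
import HarnessLib

/-!
# Kramer–Tunnell 1982, §7 Theorem 7.6 (the local norm index `#E(F)/N E(K)` of a quadratic extension
# `K/F` of local fields from the NÉRON MODELS of `E`, `E^ω` over `F` and of `E` over `K`), in the
# model-free form of the Remark on p. 333, and Corollary 7.6 — AS PRINTED (display reconstructed, see below)

Source: K. Kramer, J. Tunnell, *Elliptic curves and local ε-factors*, Compositio Math. 46 (1982) 307–352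
(NUMDAM `CM_1982__46_3_307_0`; PUBLISHED, refereed), §7 "The norm index and the Néron model", printed
pp. 328–334 (= PDF p0023–p0029 of the NUMDAM copy materialised on the hub as `paper:url-f1c2eb36a995`;
locators `pNNNN Lk` = PDF page / line of that copy; the four pages used here are also kept verbatim by the
requesting cell at `run/shared/lean/pub/bsd-f1-sign2/MEMO-desc-data/g18/kt82-pages/`). TWO named facts
(`def … : Prop`, D-0014, nothing asserted) in the vocabulary of `UnramifiedNormIndex.lean` (`normSubgroup`,
`fixedSubgroup`, the index as `AddSubgroup.relIndex`), of `Tamagawa.lean` (`localTamagawaNumber 𝒪[F]` =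
`c = #E(F)/E₀(F)` computed on Mathlib's minimal model) and of `QuadraticTwist.lean` (`E.quadraticTwist d`
= the model `A′` of Lemma 7.5). Requested by the cell `bsd-f1-sign2` (descent lens: MEMO-desc §26, asks
D-desc-63/65; typed draft `MEMO-desc-data/g18/lean/DraftKT82Thm76.lean` 2d20bbeb62fcddc0 by
planner-bsd-f1-sign2-desc g18, BC7-probed 2/2 CLEAN `ProbeKT82Thm76.verdict.txt` 7753c91fa8444c73; the two
`def` bodies below are that draft VERBATIM, lifted out of its `.Draft` namespace) as the printed source of the
cell's rows `UnramifiedNormIndexTamagawa` (= Cor. 7.6) and `RamifiedNormIndexKodairaTamagawa[AtTwo]`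
(= Thm. 7.6 + the Remark's "reader's exercise" via Ogg–Saito), placement REF2-PLACEMENT-v40-add6 (refuter
-ref2 g40, 2026-08-28T20:26:58Z): "the exact local norm index #E(F)/N E(K) for any elliptic curve over any
non-archimedean local field F with finite residue field and any quadratic K/F is a printed theorem —
[KramerTunnell1982, Thm. 7.6 (p. 332)] … GREEN from the placement side". Not in Mathlib or the tree
(2026-08-28: `rg 'Thm. 7.6|thm76|Cor. 7.6' lean/Literature/NumberTheory` → none; the `KramerTunnell1982/`
files hold §6 Lemma 6.1, §8 Prop. 8.6, §4 Prop. 4.3 and their proof inputs only).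

## The printed text, verbatim

Setting of §7 [p0023 L18–L22 = p. 328]: "7. The norm index and the Néron model. Let `E` be an elliptic
curve defined over a local field `F` with finite residue field `k_F`, ring of integers `O_F` and maximal
ideal `P_F`. Let `v_F` be the additive valuation of `F`. Let `K` be a quadratic extension of `F`. The object
of this section is to express the norm index `E(F)/NE(K)` in terms of information available from the Néron
model." — NO reduction-type and NO residue-characteristic hypothesis (REF2 add6 §1(a)).
[p0027 L3–L9 = p. 332] "LEMMA 7.5: Let `A` be a possibly non-minimal Weierstrass model for `E` over `O_F`
having discriminant `Δ`. Let `ω` be a quadratic character of `F*` and let `K` be the corresponding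
extension. There is a model `A′` for `E^ω` over `O_F` having discriminant `Δ′ = Δd⁶`, where `d` is the
discriminant of `K/F`, determined up to the square of a unit of `F`. The map `i : A′(F) → A(K)` has the form
`i(x′, y′) = (x, y)` with `x = x′/d`." [p0027 L12–L17] "Let `‖a‖_F = |k_F|^{−v_F(a)}` be the absolute
value on `F`. Let `‖ ‖_K` be the corresponding absolute value on the quadratic extension `K`, and let `ω`
be the quadratic character of `F*` corresponding to `K/F`."
[p0027 L19–L27] "THEOREM 7.6: Choose a Weierstrass model `A` for `E` over `O_F` and use the same model for
`E` over `K`. Choose a model `A′` for `E^ω` over `O_F` as in the above Lemma. In the notation of Lemma 7.1,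
let the "stretching factors" from minimality be given by `u_F = u_F(E, A)`, `u_K = u_K(E, A)`,
`u′_F = u_F(E^ω, A′)`. Let `c_F = |E(F)/E₀(F)|`, `c_K = |E(K)/E₀(K)|`, `c′_F = |E^ω(F)/E^ω₀(F)|`. Then
  `|E(F)/NE(K)| = (c_F c′_F / c_K) · ‖u_K‖_K / (‖u_F‖_F ‖u′_F‖_F)`."
DISPLAY FLAG: the displayed formula is LOST in the NUMDAM text layer; the line above is a RECONSTRUCTION,
pinned by four printed passages (REF2 add6 §1(b) for (i)–(iii); (iv) checked by this seat):
(i) [p0029 L32–L34 = p. 334] "COROLLARY 7.6: If `K/F` is unramified or if char(`k_F`) `≠ 2` then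
`‖u_K‖_K/‖u_F u′_F‖_F = 1` and `|E(F)/NE(K)| = c_F c′_F/c_K`." (fixes the shape `(c_F c′_F/c_K) × (u-term)`);
(ii) the Example [p0029 L1–L14 = p. 334]: "model `y² = x³ − x² + x` over `ℚ₂`. This is the curve 24A …
Over `ℚ₂` `E` has Kodaira type III, discriminant `Δ_E = −2⁴·3`, and `c_F = 2`. … over a ramified quadratic
extension `K` this model remains minimal and the type is I₀* with `c_K = 4`. The curves 48A, 144E, 192E and
192K are the twists of `E` by the quadratic fields `ℚ₂(√−1)`, `ℚ₂(√3)`, `ℚ₂(√−2)`, `ℚ₂(√2)` … `E(F)/NE(K)` has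
order 1 for the first two fields listed, and order 2 for the remaining two.";
(iii) [p0042 L4–L8 = p. 347, §8 types IV/IV*, `ω` ramified] "determine `t = v_F(u′_F) − v_K(u_K)` as given
above. Now `c_F, c_K ∈ {1, 3}`, while `E(F)/NE(K)` is a 2-group. Hence by Theorem 7.6
`|E(F)/NE(K)| = c′|k_F|^t`" (fixes the ORIENTATION of the u-term: `‖u_K‖_K/(‖u_F‖_F‖u′_F‖_F) = |k_F|^{v_F(u_F)
+ v_F(u′_F) − f·v_K(u_K)}`, here with `u_F = 1`, `f = 1`);
(iv) Dokchitser–Dokchitser 2011, Remark 21 [corpus: paper-arxiv-0906.1815 p0008 L17–L29]: "suppose `K` is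
non-Archimedean with char `K ≠ 2`, and that `F = K(√α)` … `E : y² = x³ + ax² + bx + c`,
`E_α : y² = x³ + αax² + α²bx + α³c`. By [KT] Thm. 7.6, `κ(E, F/K) = (−1)^{ord₂ C(E/K, dx/y) C(E_α/K, dx/y) /
C(E/F, dx/y)}`" with `C(E/K, ω) = c(E/K)·|ω/ω°|_K` (`ω°` a Néron differential; their `K`, `F` are our `F`,
`K`): since `A_min = C • A` with `Δ_min = u^{−12}Δ(A)` and `ω_min = u·ω_A` (Lemma 7.1; [SilvermanAEC2009,
III.1 Table 3.1]), `|ω_A/ω°|_F = ‖u_F‖_F^{−1}`, so the three `C`'s multiply to exactly the reconstructed right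
side. Česnavičius–Imai 2016 (p. 11 of arXiv:1504.02546): "due to [KT82] Lemma 7.1 (1), the "stretching
factors" considered in [KT82] Thm. 7.6 are determined by the valuations of the minimal discriminant and of the
discriminant of the model at hand" — which is the Remark:
[p0028 L24–L33 = p. 333] "REMARK: Clearly the norm index `E(F)/NE(K)` is independent of the choice of model
`A`. To see that the right side of the formula in Theorem 7.6 is independent of `A`, let `Δ_F`, `Δ^ω_F`, `Δ_K`
be the minimal discriminants for `E` over `F`, `E^ω` over `F` and `E` over `K`. Then [display lost; forced by
`Δ(A) = u_F¹²Δ_F`, `Δ(A)d⁶ = u′_F¹²Δ^ω_F`, `Δ(A) = u_K¹²Δ_K` and `‖a‖_K = ‖a‖_F²` for `a ∈ F`:]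
  `‖u_K‖_K/(‖u_F‖_F ‖u′_F‖_F) = ( ‖Δ_F‖_F ‖Δ^ω_F‖_F / (‖d‖_F⁶ ‖Δ_K‖_K) )^{1/12}`.
Hence [display lost: Theorem 7.6 with this substitution]. We leave it to the reader to express this in terms
of conductors and numbers of components in the singular fibers of the Néron models."
In valuations (`q = |k_F|`, `f` = residue degree of `K/F`, `δ = v_F(d)` = the valuation of the discriminant
of `K/F`, `‖a‖_K = q^{−f·v_K(a)}`): `|E(F)/NE(K)| · c_K = c_F · c′_F · q^e` with
`12 e = 6δ + f·v_K(Δ_K) − v_F(Δ_F) − v_F(Δ^ω_F)` — the typed form below (`e ∈ ℤ`; `e = 0` in Cor. 7.6).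

## Transcription (Mathlib / tree vocabulary; nothing re-declared)

* `F`: a Mathlib nonarchimedean local field (`[ValuativeRel F] [TopologicalSpace F]
  [IsNonarchimedeanLocalField F]`), with `(2 : F) ≠ 0` ONLY because the twist `E^ω` is written with the
  tree's `WeierstrassCurve.quadraticTwist d` (the `char ≠ 2` model `y² = x³ + (d b₂/4)x² + (d² b₄/2)x + d³ b₆/4`,
  i.e. the printed `A′` with `Δ′ = Δ d⁶`); residue characteristic `2` (the requesting cell's case) IS covered.
* `K/F` quadratic: an abstract local field `K'` (`[IsNonarchimedeanLocalField K']`) with a continuous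
  `F`-algebra structure of degree `2` containing a square root `x` of the non-square `d ∈ F` (so `K' = F(√d)`
  and `d ≡` the discriminant of `K'/F` modulo squares — twisting by `d` or by the discriminant gives
  `F`-isomorphic curves, and only `‖d‖_F` of the DISCRIMINANT enters, as `δ` below); `σ ≠ 1` its
  `F`-automorphism (the generator of `Gal(K/F)`), as in `prop86_ordinaryNormIndexResidueCharTwo`. `K'` is a
  type of its own (not an `IntermediateField F F̄` as in Lemma 6.1 / Prop. 8.6) because Theorem 7.6 needs the
  valuation ring `𝒪[K']`, its residue field and `v_{K'}` on the `K`-side (`c_K`, `Δ_K`).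
* residue degree `f` and discriminant exponent `δ`: supplied by explicit witnesses instead of an
  `Algebra 𝒪[F] 𝒪[K']` instance (which Mathlib does not derive from `Algebra F K'`): `|k_{K'}| = |k_F|^f`;
  a monogenic integral basis `𝒪[K'] = 𝒪[F]·1 + 𝒪[F]·α` (always available for an extension of local fields,
  [SerreLocalFields1979, III §6 Prop. 12]), a uniformiser `ϖ` of `K'` and `t = v_{K'}(α − σα)`, so that the
  different is `𝔇_{K'/F} = (α − σα) = 𝔭_{K'}^t` and `δ = v_F(𝔡_{K'/F}) = v_F(N 𝔇) = f·t`
  ([SerreLocalFields1979, III §6 Cor. 2 of Prop. 11 and III §3 Prop. 6]).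
* `c_F`, `c′_F`, `c_K`: `localTamagawaNumber` over `𝒪[F]`, `𝒪[F]`, `𝒪[K']` of `E`, `E.quadraticTwist d`,
  `E.baseChange K'` (tree `Tamagawa.lean`: `#E(F)/E₀(F)` on Mathlib's minimal model).
* `v_F(Δ_F)`, `v_F(Δ^ω_F)`, `v_K(Δ_K)`: `(addVal 𝒪[·] ((·.minimal 𝒪[·]).integralModel 𝒪[·]).Δ).toNat` — the
  valuation of the discriminant of Mathlib's integral minimal model (the device of the tree's
  `ordMinimalDiscriminant` / `kodairaSymbol`; model-independent by [SilvermanAEC2009, VII.1 Prop. 1.3(b)]).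
* `|E(F)/NE(K)|`: `(normSubgroup E K' σ).relIndex (fixedSubgroup E K' σ)` exactly as in Lemma 6.1 / Prop.
  8.6 (`fixedSubgroup = E(K')^σ = E(F)` by Galois descent; `0` would encode an infinite index, which the
  typed equation then makes FALSE, not junk-true — the printed theorem includes finiteness, Cor. 7.3.1).
* The conclusion is stated in `ℚ` with `e : ℤ` (`q^e` may be a proper fraction: e.g. `e < 0` occurs when
  `A = A_min` over `F` stops being minimal over a ramified `K`).

Faithfulness: `thm76_normIndexNeronModels` is Theorem 7.6 with the Remark's substitution (the printed
model-free form), hypotheses verbatim (none beyond the setting of §7); `cor76_normIndex_eq_tamagawaRatio` is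
Corollary 7.6 verbatim, its two printed cases ("`K/F` unramified" typed as `|k_{K'}| = |k_F|²`; "char(`k_F`)
`≠ 2`" typed as `IsUnit (2 : 𝒪[F])`). Weaker than print ONLY in `(2 : F) ≠ 0` (the source allows local
fields of characteristic `2`, where `E^ω` is an Artin–Schreier twist — see the `TODO(general form)` below).
NOT recorded: the model-dependent display with stretching factors itself (no tree notion of `u_F(E, A)`),
Lemmas 7.1–7.5, Prop. 7.3, the Example, and the §8 evaluations (Prop. 8.6 is `ResidueCharTwoOrdinaryNormIndex`).
The Kramer–Tunnell CONJECTURE 3.1 (root numbers) is a different statement, now a theorem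
([DokchitserDokchitser2011, Thm. 5]; [CesnaviciusImai2016]) and is not typed here.
-/

noncomputable section

open ValuativeRel Field
open Literature.NumberTheory.GaloisRepresentations.IsNonarchimedeanLocalField
open Literature.NumberTheory.DiophantineGeometry

namespace Literature.NumberTheory.EllipticCurves.KramerTunnell1982

open scoped Classical

/-- **Kramer–Tunnell 1982, Theorem 7.6 with the Remark on p. 333 (model-free form): the quadratic norm index
from minimal discriminants and Tamagawa numbers.** For a nonarchimedean local field `F` (`2 ≠ 0`), an elliptic
curve `E/F`, a separable quadratic extension `K' = F(√d)` with non-trivial automorphism `σ`, residue degree `f`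
and discriminant exponent `δ = v_F(𝔡_{K'/F})`:
`#E(F)/N E(K') · c(E/K') = c(E/F) · c(E^d/F) · q^e` where `12 e = 6δ + f·v_{K'}(Δ_min(E/K')) − v_F(Δ_min(E/F)) − v_F(Δ_min(E^d/F))`
(`q = #k_F`). [cite: KramerTunnell1982, Thm. 7.6, Remark p. 333, Cor. 7.6 p. 334] -/
def thm76_normIndexNeronModels : Prop :=
  ∀ (F : Type) [Field F] [ValuativeRel F] [TopologicalSpace F] [IsNonarchimedeanLocalField F]
    (_h2F : (2 : F) ≠ 0) (E : WeierstrassCurve F) [E.IsElliptic] (d : F) (_hd : ¬ IsSquare d)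
    (K' : Type) [Field K'] [ValuativeRel K'] [TopologicalSpace K'] [IsNonarchimedeanLocalField K']
    [Algebra F K'] (_hcont : Continuous (algebraMap F K')) (_hK : Module.finrank F K' = 2)
    (σ : K' ≃ₐ[F] K') (_hσ : σ ≠ 1) (x : K') (_hx : x ^ 2 = algebraMap F K' d)
    -- residue degree `f` (so `f ∈ {1, 2}`):
    (f : ℕ) (_hf : Nat.card (IsLocalRing.ResidueField 𝒪[K']) = Nat.card (IsLocalRing.ResidueField 𝒪[F]) ^ f)
    -- a monogenic integral basis `1, α` of `𝒪_{K'}` over `𝒪_F`, a uniformiser `ϖ` of `K'`, and the different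
    -- exponent `t = v_{K'}(α − σα)`; then `δ := f · t = v_F(𝔡_{K'/F})`:
    (α ϖ : 𝒪[K']) (_hϖ : Irreducible ϖ)
    (_hα : ∀ z : 𝒪[K'], ∃ a b : 𝒪[F], (z : K') = algebraMap F K' a + algebraMap F K' b * α)
    (t : ℕ) (_ht : ∃ u : 𝒪[K'], IsUnit u ∧ (α : K') - σ (α : K') = (u : K') * (ϖ : K') ^ t),
    let q : ℕ := Nat.card (IsLocalRing.ResidueField 𝒪[F])
    let δ : ℕ := f * t
    let c : ℕ := E.localTamagawaNumber 𝒪[F]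
    let c' : ℕ := (E.quadraticTwist d).localTamagawaNumber 𝒪[F]
    let cK : ℕ := (E.baseChange K').localTamagawaNumber 𝒪[K']
    let vΔ : ℕ := (IsDiscreteValuationRing.addVal 𝒪[F] ((E.minimal 𝒪[F]).integralModel 𝒪[F]).Δ).toNat
    let vΔ' : ℕ := (IsDiscreteValuationRing.addVal 𝒪[F]
      (((E.quadraticTwist d).minimal 𝒪[F]).integralModel 𝒪[F]).Δ).toNat
    let vΔK : ℕ := (IsDiscreteValuationRing.addVal 𝒪[K']
      (((E.baseChange K').minimal 𝒪[K']).integralModel 𝒪[K']).Δ).toNat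
    ∃ e : ℤ, 12 * e = 6 * (δ : ℤ) + f * vΔK - vΔ - vΔ' ∧
      ((normSubgroup E K' σ).relIndex (fixedSubgroup E K' σ) : ℚ) * cK = c * c' * (q : ℚ) ^ e

/-- **Corollary 7.6 (p. 334), the `q`-power vanishes:** «If K/F is unramified or if char(k_F) ≠ 2 then
‖u_K‖_K/‖u_F u'_F‖_F = 1 and |E(F)/NE(K)| = c_F c'_F/c_K.» Typed for the two printed cases separately
(unramified: residue field of `K'` has `q²` elements; odd residue characteristic: `2` a unit of `𝒪_F`).
[cite: KramerTunnell1982, Cor. 7.6 p. 334] -/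
def cor76_normIndex_eq_tamagawaRatio : Prop :=
  ∀ (F : Type) [Field F] [ValuativeRel F] [TopologicalSpace F] [IsNonarchimedeanLocalField F]
    (_h2F : (2 : F) ≠ 0) (E : WeierstrassCurve F) [E.IsElliptic] (d : F) (_hd : ¬ IsSquare d)
    (K' : Type) [Field K'] [ValuativeRel K'] [TopologicalSpace K'] [IsNonarchimedeanLocalField K']
    [Algebra F K'] (_hcont : Continuous (algebraMap F K')) (_hK : Module.finrank F K' = 2)
    (σ : K' ≃ₐ[F] K') (_hσ : σ ≠ 1) (x : K') (_hx : x ^ 2 = algebraMap F K' d)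
    (_h : Nat.card (IsLocalRing.ResidueField 𝒪[K']) = Nat.card (IsLocalRing.ResidueField 𝒪[F]) ^ 2
        ∨ IsUnit (2 : 𝒪[F])),
    (normSubgroup E K' σ).relIndex (fixedSubgroup E K' σ) * (E.baseChange K').localTamagawaNumber 𝒪[K'] =
      E.localTamagawaNumber 𝒪[F] * (E.quadraticTwist d).localTamagawaNumber 𝒪[F]


-- TODO(general form): the source allows `char F = 2` (then `E^ω` is an Artin–Schreier twist, not `quadraticTwist d`);
-- the model-dependent display with stretching factors `u_F(E, A)` (Lemma 7.1) is not recorded either.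

end Literature.NumberTheory.EllipticCurves.KramerTunnell1982

end
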